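import Mathlib
import Summits.NavierStokesRegularity.NavierStokesRegularity.Theorems.FilamentSkeletonRssAreaLawSlavingHoloStadiumAreaOfSlip

/-!
# Area-law slaving, complex part 10 — `StadiumAnalyticArea` of the slaved area, REAL-SLIP form (the crux's letters)
# (`FilamentSkeletonRss`, child crux `TangentSkeletonNearStraight`, stmt-NavierStokesRegularity-28295, line
# `child_tangent_analytic_strip`, ∃-side of the registered stub `stub_analyticClosing`: the `StadiumAnalyticArea` conjunct)

Complex part 9 (`stadium_analytic_area_of_slip`) states the real area law against the real trace `x ↦ Re w(x)` of the holomorphic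
slip and its `deriv`.  In the crux (`FlatJ1G`) the area law is written for a REAL slip `wj : ℝ → ℝ` defined on all of `ℝ`
(`wj τ = ⟪v (X j τ), X j′ τ⟫`) and the slaved area `Aa j`: `wj τ * deriv (Aa j) τ = (3/2 − deriv wj τ) * Aa j τ + 4`.  This file is the
two-line bridge: if `Re w(x) = wj x` at the real points of the stadium, then `deriv wj = deriv (Re w ∘ ↑)` there (the trace is open in
`ℝ`), so the crux's clause feeds part 9 verbatim.

* `deriv_trace_congr` — `deriv` of two real functions agreeing on the (open) real trace coincide there;
* `stadium_analytic_area_of_real_slip` — part 9 with the area law stated for `wj`.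

HONEST FRAMING: bookkeeping serving a HYPOTHETICAL filament skeleton on the NEGATIVE side of a MODEL route; no registered stub is closed by
this file and nothing here bears on Navier–Stokes regularity or blow-up.  `--supports stmt-NavierStokesRegularity-28295`.
-/

set_option linter.dupNamespace false

noncomputable section

namespace Summit.NavierStokesRegularity.NavierStokesRegularity.Theorems.AreaLawSlavingHolo

open Set Metric Filter Real
open scoped Topology

/-- Two real functions that agree at the real points of an open set `U ⊆ ℂ` have the same `deriv` at those points. [folklore] -/
theorem deriv_trace_congr {U : Set ℂ} (hUo : IsOpen U) {f g : ℝ → ℝ} (hfg : ∀ x : ℝ, (x : ℂ) ∈ U → f x = g x) {x : ℝ}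
    (hx : (x : ℂ) ∈ U) : deriv f x = deriv g x := by
  have hT : {t : ℝ | (t : ℂ) ∈ U} ∈ 𝓝 x := (hUo.preimage Complex.continuous_ofReal).mem_nhds hx
  exact Filter.EventuallyEq.deriv_eq (Filter.eventually_of_mem hT (fun t ht => hfg t ht))

/-- **`StadiumAnalyticArea` of the slaved area, real-slip form.**  As `stadium_analytic_area_of_slip`, with the real area law written
for a real slip `wj : ℝ → ℝ` that agrees with `Re w` at the real points of the stadium (the crux's `FlatJ1G` clause
`wj τ * deriv Aa τ = (3/2 − deriv wj τ) * Aa τ + 4`, restricted to the trace). [folklore] -/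
theorem stadium_analytic_area_of_real_slip {hs L cc c r₁ K₂ M μ₀ Amin : ℝ} {U : Set ℂ}
    (hU : U = {z : ℂ | |z.im| < hs ∧ |z.re - cc| < L + hs}) (hr₁ : 0 ≤ r₁) (hrect : |c - cc| + r₁ < L + hs)
    {w : ℂ → ℂ} (hw : DifferentiableOn ℂ w U) {wj : ℝ → ℝ} (hwj : ∀ x : ℝ, (x : ℂ) ∈ U → (w x).re = wj x)
    (hw_re : ∀ x : ℝ, (x : ℂ) ∈ U → (w x).im = 0)
    (hwc : w c = 0) (hwc_re : 3 / 2 < (deriv w c).re)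
    (hK₂ : ∀ ζ ∈ U, ‖deriv (deriv w) ζ‖ ≤ K₂) (hK₂r : K₂ * (r₁ + hs) ≤ 1 / 4)
    (hM : ∀ ζ ∈ U, ‖deriv w ζ‖ ≤ M) (hμ₀ : 0 < μ₀)
    (hfloor : ∀ x : ℝ, (x : ℂ) ∈ U → r₁ < |x - c| → μ₀ ≤ ‖w x‖)
    {A : ℝ → ℝ} (hAd : ∀ x : ℝ, (x : ℂ) ∈ U → DifferentiableAt ℝ A x)
    (hAeq : ∀ x : ℝ, (x : ℂ) ∈ U → wj x * deriv A x = (3 / 2 - deriv wj x) * A x + 4)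
    (hAmin : 0 < Amin) (hA : ∀ x : ℝ, (x : ℂ) ∈ U → Amin ≤ A x) (hthin : (18 + 12 * M + 48 / Amin) * hs ≤ μ₀) :
    ∃ G : ℂ → ℂ, DifferentiableOn ℂ G {z : ℂ | |z.im| < hs ∧ |z.re - cc| < L + hs} ∧
      (∀ t : ℝ, (t : ℂ) ∈ {z : ℂ | |z.im| < hs ∧ |z.re - cc| < L + hs} → G t = ((A t : ℝ) : ℂ)) ∧
      ∀ z ∈ {z : ℂ | |z.im| < hs ∧ |z.re - cc| < L + hs}, A z.re / 2 ≤ (G z).re ∧ ‖G z‖ ≤ 2 * A z.re := by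
  have hUo : IsOpen U := by rw [hU]; exact thinStadium_isOpen hs L cc
  have hAeq' : ∀ x : ℝ, (x : ℂ) ∈ U →
      (w x).re * deriv A x = (3 / 2 - deriv (fun t : ℝ => (w t).re) x) * A x + 4 := by
    intro x hx
    rw [hwj x hx, deriv_trace_congr hUo hwj hx]
    exact hAeq x hx
  exact stadium_analytic_area_of_slip hU hr₁ hrect hw hw_re hwc hwc_re hK₂ hK₂r hM hμ₀ hfloor hAd hAeq' hAmin hA hthin

end Summit.NavierStokesRegularity.NavierStokesRegularity.Theorems.AreaLawSlavingHolo
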